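import Literature.Topology.FourManifolds.TrisectionFunctor
import Literature.Topology.FourManifolds.SPC4HandlesProofs
import Literature.Topology.FourManifolds.NormalRetraction
import Literature.Topology.FourManifolds.SmoothEmbeddingCriteria
import Literature.Topology.FourManifolds.BallGluingCharts
import Mathlib.Geometry.Manifold.WhitneyEmbedding
import Mathlib.Geometry.Manifold.PartitionOfUnity
import Mathlib.AlgebraicTopology.FundamentalGroupoid.FundamentalGroup
import HarnessLib

/-!
# Ambient smoothness of maps defined on smoothly embedded boundaries (Milnor's smooth maps on subsets)

Topic `Literature/Topology/FourManifolds`, next to `NormalRetraction.lean` and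
`SmoothEmbeddingCriteria.lean`.  A map defined on a subset `K ⊆ X` of a smooth manifold is *smooth*
in Milnor's sense (*Topology from the differentiable viewpoint* (1965), §1, p. 1) if near every point
of `K` it is the restriction of a smooth map of an open subset of `X`; for maps into `ℝᴺ` such local
extensions glue by partitions of unity, and for maps into a compact manifold `Y` one glues in `ℝᴺ`
after a Whitney embedding `Y ↪ ℝᴺ` and projects back with a smooth retraction of a tube (Hirsch,
*Differential Topology* (1976), Ch. 4 §5, Thm. 5.1–5.2 — the tree's `exists_normalRetraction`).
This file proves the two facts in the `4`-dimensional setting in which the trisection programme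
consumes them (central surfaces `F = h(∂H)` of Gay–Kirby trisections, `h : H³ ↪ X⁴` a smooth
embedding of a handlebody):

* `Literature.Topology.FourManifolds.exists_local_ambient_extension` — **local ambient extension
  along a smoothly embedded `3`-manifold with boundary**: if `h₁ : M → X` is a smooth embedding
  (`Manifold.IsSmoothEmbedding (𝓡∂ 3) (𝓡 4)`), `σ : T → ∂M` has a left inverse `τ` smooth along
  `∂M`, and `F : T → Y` is smooth, then near each `h₁ (σ z)` some smooth map `Ψ` of an OPEN subset
  of `X` satisfies `Ψ (h₁ (σ z')) = F z'` (slice charts of the immersion at a boundary point, Mathlib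
  `Manifold.IsImmersionAtOfComplement.writtenInCharts`; invariance of the boundary for charts of
  the maximal atlas, the tree's `isBoundaryPoint_iff_of_mem_maximalAtlas`; the linear projection
  onto the boundary hyperplane of the half-space model);
* `Literature.Topology.FourManifolds.exists_ambient_extension_of_local` — **gluing**: a map on a
  closed subset `K` of a compact `4`-manifold into a compact `4`-manifold `Y` that is locally the
  restriction of smooth maps is the restriction of ONE smooth map of an open neighbourhood of `K`
  (Whitney embedding, Mathlib `exists_embedding_euclidean_of_compact`; `exists_normalRetraction`;
  Mathlib `exists_contMDiffMap_forall_mem_convex_of_local`);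
* `Literature.Topology.FourManifolds.exists_homeomorph_boundary_centralSurface` — `∂H ≃ₜ F` along a
  clause-(iii) embedding `f : H → X` of a trisection (`f(∂H) = F`), equal to `f` on points;
* `Literature.Topology.FourManifolds.FundamentalGroup.mapOfEq_trans_trans_apply` — `π₁`
  functoriality for a triple composite of based homeomorphisms (Hatcher, Prop. 1.18).

All proved (no `sorry`, standard axioms).

## References

* J. Milnor, *Topology from the differentiable viewpoint* (1965), §1.
* M. W. Hirsch, *Differential Topology*, GTM 33 (1976), Ch. 4 §5, Thm. 5.1–5.2. [HirschDT1976]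
* J. M. Lee, *Introduction to Smooth Manifolds* (2013), Thm. 1.46, Thm. 5.8. [LeeSmoothManifolds2013]
-/

open scoped Manifold ContDiff Topology ContinuousMap
open Set Function

noncomputable section

namespace Literature.Topology.FourManifolds


/-! ## Local ambient extension along a smoothly embedded `3`-manifold with boundary -/

section LocalExtension

variable {M : Type*} [TopologicalSpace M] [ChartedSpace (EuclideanHalfSpace 3) M]
  [IsManifold (𝓡∂ 3) ∞ M]
  {X : Type*} [TopologicalSpace X] [ChartedSpace (EuclideanSpace ℝ (Fin 4)) X]
  {Y : Type*} [TopologicalSpace Y] [ChartedSpace (EuclideanSpace ℝ (Fin 4)) Y]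
  {T : Type*} [TopologicalSpace T] [ChartedSpace (EuclideanSpace ℝ (Fin 2)) T]

/-- Points of the boundary hyperplane lie in the range of the half-space model. [folklore] -/
theorem mem_range_of_apply_zero {u : EuclideanSpace ℝ (Fin 3)} (h : u 0 = 0) :
    u ∈ range (𝓡∂ 3) := by
  rw [range_modelWithCornersEuclideanHalfSpace]
  exact le_of_eq h.symm

/-- Points of the boundary hyperplane lie in the frontier of the range of the half-space model.
[folklore] -/
theorem mem_frontier_range_iff {u : EuclideanSpace ℝ (Fin 3)} :
    u ∈ frontier (range (𝓡∂ 3)) ↔ u 0 = 0 := by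
  rw [frontier_range_modelWithCornersEuclideanHalfSpace]
  exact ⟨fun h => (h : 0 = u 0).symm, fun h => (h.symm : 0 = u 0)⟩

/-- **Local ambient extension along a smoothly embedded `3`-manifold with boundary.**  Let
`h₁ : M → X` be a smooth embedding of a `3`-manifold with boundary into a `4`-manifold, let
`σ : T → M` take values in `∂M` and have a left inverse `τ` that is smooth along `∂M`, and let
`F : T → Y` be smooth.  Then near `h₁ (σ z)` there is a smooth map `Ψ` of an open set of `X` with
`Ψ (h₁ (σ z')) = F z'`: in the slice charts `(φ, χ, L)` of the immersion `h₁` at `σ z`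
(`χ ∘ h₁ ∘ φ⁻¹ = L ∘ (·, 0)`), `Ψ = F ∘ τ ∘ φ⁻¹ ∘ flatten ∘ pr₁ ∘ L⁻¹ ∘ χ`, where `flatten`
projects onto the boundary hyperplane, which `φ` identifies with `∂M` (invariance of the
boundary).  (Milnor's notion of a smooth map on the subset `h₁(∂M)`: Milnor, *Topology from the
differentiable viewpoint* (1965), §1; Lee (2013), Thm. 1.46, Thm. 5.8.) [folklore] -/
theorem exists_local_ambient_extension {h₁ : M → X}
    (hh₁ : Manifold.IsSmoothEmbedding (𝓡∂ 3) (𝓡 4) ∞ h₁)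
    {σ : T → M} {τ : M → T} (hτσ : ∀ z, τ (σ z) = z) (hσ : ∀ z, σ z ∈ (𝓡∂ 3).boundary M)
    (hτ : ContMDiffOn (𝓡∂ 3) (𝓡 2) ∞ τ ((𝓡∂ 3).boundary M))
    {F : T → Y} (hF : ContMDiff (𝓡 2) (𝓡 4) ∞ F) (z : T) :
    ∃ V : Set X, IsOpen V ∧ h₁ (σ z) ∈ V ∧ ∃ Ψ : X → Y, ContMDiffOn (𝓡 4) (𝓡 4) ∞ Ψ V ∧
      ∀ z', h₁ (σ z') ∈ V → Ψ (h₁ (σ z')) = F z' := by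
  obtain ⟨C, _, _, hC⟩ := hh₁.isImmersion
  have hm := hC (σ z)
  -- the linear projection of `ℝ³` onto the boundary hyperplane `{u | u 0 = 0}`, `u ↦ u - u₀ • e₀`
  let flatten : EuclideanSpace ℝ (Fin 3) →L[ℝ] EuclideanSpace ℝ (Fin 3) :=
    ContinuousLinearMap.id ℝ _ -
      (EuclideanSpace.proj (0 : Fin 3)).smulRight (EuclideanSpace.single (0 : Fin 3) (1 : ℝ))
  have flatten_apply : ∀ u : EuclideanSpace ℝ (Fin 3),
      flatten u = u - u 0 • EuclideanSpace.single (0 : Fin 3) (1 : ℝ) := fun u => rfl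
  have flatten_apply_zero : ∀ u : EuclideanSpace ℝ (Fin 3), flatten u 0 = 0 := fun u => by
    simp [flatten_apply]
  have flatten_of_apply_zero : ∀ {u : EuclideanSpace ℝ (Fin 3)}, u 0 = 0 → flatten u = u :=
    fun {u} h => by simp [flatten_apply, h]
  -- the slice charts `(φ, χ, L)` of the immersion at the boundary point `σ z`
  -- an open `U₁ ⊆ X` cutting `hm.domChart.source` out of `M`
  obtain ⟨U₁, hU₁, hU₁eq⟩ := hh₁.isEmbedding.isInducing.isOpen_iff.1 hm.domChart.open_source
  -- the coordinate map `q = flatten ∘ pr₁ ∘ L⁻¹ ∘ χ`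
  set q : X → EuclideanSpace ℝ (Fin 3) := fun x => flatten (hm.equiv.symm (hm.codChart.extend (𝓡 4) x)).1 with hq
  have hqs : ContMDiffOn (𝓡 4) 𝓘(ℝ, EuclideanSpace ℝ (Fin 3)) ∞ q hm.codChart.source := by
    have h1 : ContMDiffOn (𝓡 4) 𝓘(ℝ, EuclideanSpace ℝ (Fin 4)) ∞ (hm.codChart.extend (𝓡 4)) hm.codChart.source :=
      hm.codChart.contMDiffOn_extend hm.codChart_mem_maximalAtlas
    have h2 : ContMDiff 𝓘(ℝ, EuclideanSpace ℝ (Fin 4)) 𝓘(ℝ, EuclideanSpace ℝ (Fin 3)) ∞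
        (fun v => flatten (hm.equiv.symm v).1) := by
      rw [contMDiff_iff_contDiff]
      exact flatten.contDiff.comp (contDiff_fst.comp hm.equiv.symm.contDiff)
    exact h2.comp_contMDiffOn h1
  have hq0 : ∀ x, q x 0 = 0 := fun x => flatten_apply_zero _
  -- key computation: on `h₁ (hm.domChart.source ∩ ∂M)` the map `q` is the chart `φ`
  have key : ∀ w ∈ hm.domChart.source, w ∈ (𝓡∂ 3).boundary M →
      q (h₁ w) = hm.domChart.extend (𝓡∂ 3) w ∧ hm.domChart.extend (𝓡∂ 3) w ∈ (hm.domChart.extend (𝓡∂ 3)).target := by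
    intro w hw hwb
    have hws : w ∈ (hm.domChart.extend (𝓡∂ 3)).source := by rwa [OpenPartialHomeomorph.extend_source]
    have hu : hm.domChart.extend (𝓡∂ 3) w ∈ (hm.domChart.extend (𝓡∂ 3)).target := (hm.domChart.extend (𝓡∂ 3)).map_source hws
    refine ⟨?_, hu⟩
    have hwr := hm.writtenInCharts hu
    simp only [comp_apply, (hm.domChart.extend (𝓡∂ 3)).left_inv hws] at hwr
    have h0 : hm.domChart.extend (𝓡∂ 3) w 0 = 0 := by
      rw [← mem_frontier_range_iff]
      exact (isBoundaryPoint_iff_of_mem_maximalAtlas (I := 𝓡∂ 3) (m := ∞) (by simp)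
        hm.domChart_mem_maximalAtlas hw).1 hwb
    show flatten (hm.equiv.symm (hm.codChart.extend (𝓡 4) (h₁ w))).1 = _
    rw [hwr, ContinuousLinearEquiv.symm_apply_apply]
    exact flatten_of_apply_zero h0
  -- the open set
  refine ⟨U₁ ∩ (hm.codChart.source ∩ q ⁻¹' ((𝓡∂ 3).symm ⁻¹' hm.domChart.target)), ?_, ?_, ?_⟩
  · refine hU₁.inter (hqs.continuousOn.isOpen_inter_preimage hm.codChart.open_source ?_)
    exact hm.domChart.open_target.preimage (𝓡∂ 3).continuous_symm
  · have hzs : σ z ∈ hm.domChart.source := hm.mem_domChart_source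
    refine ⟨?_, hm.mem_codChart_source, ?_⟩
    · show σ z ∈ h₁ ⁻¹' U₁
      rw [hU₁eq]
      exact hzs
    · obtain ⟨hq', hu⟩ := key (σ z) hzs (hσ z)
      show q (h₁ (σ z)) ∈ (𝓡∂ 3).symm ⁻¹' hm.domChart.target
      rw [hq']
      rw [OpenPartialHomeomorph.extend_target] at hu
      exact hu.1
  -- the extension
  refine ⟨fun x => F (τ ((hm.domChart.extend (𝓡∂ 3)).symm (q x))), ?_, ?_⟩
  · -- smoothness
    have hmaps₁ : MapsTo q (U₁ ∩ (hm.codChart.source ∩ q ⁻¹' ((𝓡∂ 3).symm ⁻¹' hm.domChart.target)))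
        ((𝓡∂ 3) '' hm.domChart.target) := by
      rintro x ⟨-, -, hx⟩
      refine ⟨(𝓡∂ 3).symm (q x), hx, ?_⟩
      exact (𝓡∂ 3).right_inv (mem_range_of_apply_zero (hq0 x))
    have htarget : ∀ x ∈ U₁ ∩ (hm.codChart.source ∩ q ⁻¹' ((𝓡∂ 3).symm ⁻¹' hm.domChart.target)),
        q x ∈ (hm.domChart.extend (𝓡∂ 3)).target := by
      rintro x ⟨-, -, hx⟩
      rw [OpenPartialHomeomorph.extend_target]
      exact ⟨hx, mem_range_of_apply_zero (hq0 x)⟩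
    have hmaps₂ : ∀ x ∈ U₁ ∩ (hm.codChart.source ∩ q ⁻¹' ((𝓡∂ 3).symm ⁻¹' hm.domChart.target)),
        (hm.domChart.extend (𝓡∂ 3)).symm (q x) ∈ (𝓡∂ 3).boundary M := by
      intro x hx
      have ht := htarget x hx
      have hsrc : (hm.domChart.extend (𝓡∂ 3)).symm (q x) ∈ hm.domChart.source := by
        rw [← OpenPartialHomeomorph.extend_source (I := 𝓡∂ 3)]
        exact (hm.domChart.extend (𝓡∂ 3)).map_target ht
      show (𝓡∂ 3).IsBoundaryPoint _
      rw [isBoundaryPoint_iff_of_mem_maximalAtlas (I := 𝓡∂ 3) (m := ∞) (by simp)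
        hm.domChart_mem_maximalAtlas hsrc, (hm.domChart.extend (𝓡∂ 3)).right_inv ht, mem_frontier_range_iff]
      exact hq0 x
    have h1 : ContMDiffOn (𝓡 4) (𝓡∂ 3) ∞ (fun x => (hm.domChart.extend (𝓡∂ 3)).symm (q x))
        (U₁ ∩ (hm.codChart.source ∩ q ⁻¹' ((𝓡∂ 3).symm ⁻¹' hm.domChart.target))) :=
      (contMDiffOn_extend_symm hm.domChart_mem_maximalAtlas).comp
        (hqs.mono fun x hx => hx.2.1) hmaps₁
    have h2 : ContMDiffOn (𝓡 4) (𝓡 2) ∞ (fun x => τ ((hm.domChart.extend (𝓡∂ 3)).symm (q x)))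
        (U₁ ∩ (hm.codChart.source ∩ q ⁻¹' ((𝓡∂ 3).symm ⁻¹' hm.domChart.target))) :=
      hτ.comp h1 hmaps₂
    exact hF.comp_contMDiffOn h2
  · -- values on `h₁ (σ T)`
    rintro z' ⟨hz'U, -, -⟩
    have hz's : σ z' ∈ hm.domChart.source := by
      rw [← hU₁eq]
      exact hz'U
    obtain ⟨hq', -⟩ := key (σ z') hz's (hσ z')
    have hws : σ z' ∈ (hm.domChart.extend (𝓡∂ 3)).source := by rwa [OpenPartialHomeomorph.extend_source]
    show F (τ ((hm.domChart.extend (𝓡∂ 3)).symm (q (h₁ (σ z'))))) = F z'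
    rw [hq', (hm.domChart.extend (𝓡∂ 3)).left_inv hws, hτσ]

end LocalExtension

/-! ## Gluing local ambient extensions: Whitney embedding, normal retraction, partition of unity -/

section Gluing

variable {X : Type*} [TopologicalSpace X] [T2Space X] [CompactSpace X]
  [ChartedSpace (EuclideanSpace ℝ (Fin 4)) X] [IsManifold (𝓡 4) ∞ X]
  {Y : Type*} [TopologicalSpace Y] [T2Space Y] [CompactSpace Y] [Nonempty Y]
  [ChartedSpace (EuclideanSpace ℝ (Fin 4)) Y] [IsManifold (𝓡 4) ∞ Y]

/-- **A map on a closed subset of a compact `4`-manifold that is locally the restriction of smooth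
maps is the restriction of ONE smooth map of a neighbourhood** (Milnor's smooth maps on subsets
glue): embed the target `Y ↪ ℝᴺ` (Whitney, `exists_embedding_euclidean_of_compact`) with a smooth
normal retraction `r` of an open tube (`exists_normalRetraction`, Hirsch Ch. 4 §5), average the
local extensions in `ℝᴺ` with a smooth partition of unity
(`exists_contMDiffMap_forall_mem_convex_of_local`), and retract.
[cite: HirschDT1976, Ch. 4 §5 Thm. 5.1–5.2] -/
theorem exists_ambient_extension_of_local {K : Set X} (hK : IsClosed K) (f : ↥K → Y)
    (hloc : ∀ x ∈ K, ∃ V : Set X, IsOpen V ∧ x ∈ V ∧ ∃ Ψ : X → Y,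
      ContMDiffOn (𝓡 4) (𝓡 4) ∞ Ψ V ∧ ∀ (y : X) (hy : y ∈ K), y ∈ V → Ψ y = f ⟨y, hy⟩) :
    ∃ (U : Set X) (Ψ : X → Y), IsOpen U ∧ K ⊆ U ∧ ContMDiffOn (𝓡 4) (𝓡 4) ∞ Ψ U ∧
      ∀ y : ↥K, Ψ y = f y := by
  classical
  obtain ⟨N, j, hj, hjemb, hjinj⟩ := exists_embedding_euclidean_of_compact (I := 𝓡 4) (M := Y)
  obtain ⟨ε, hε, hW, hr, hret⟩ := exists_normalRetraction (I := 𝓡 4) hj hjemb.injective hjinj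
  have hrj : ∀ y, j y ∈ normalTube (𝓡 4) j ε ∧ normalRetraction (𝓡 4) j ε (j y) = y := fun y => by
    simpa using hret y 0 (Submodule.zero_mem _) (by simpa using hε)
  -- the convex targets: the prescribed value on `K`, anything off `K`
  let t : X → Set (EuclideanSpace ℝ (Fin N)) := fun x =>
    if hx : x ∈ K then {j (f ⟨x, hx⟩)} else univ
  have ht : ∀ x, Convex ℝ (t x) := fun x => by
    by_cases hx : x ∈ K
    · simp only [t, dif_pos hx]
      exact convex_singleton _
    · simp only [t, dif_neg hx]
      exact convex_univ
  have hloc' : ∀ x : X, ∃ U ∈ 𝓝 x, ∃ g : X → EuclideanSpace ℝ (Fin N),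
      ContMDiffOn (𝓡 4) 𝓘(ℝ, EuclideanSpace ℝ (Fin N)) ∞ g U ∧ ∀ y ∈ U, g y ∈ t y := by
    intro x
    by_cases hx : x ∈ K
    · obtain ⟨V, hV, hxV, Ψ, hΨ, hΨf⟩ := hloc x hx
      refine ⟨V, hV.mem_nhds hxV, j ∘ Ψ, hj.comp_contMDiffOn hΨ, fun y hy => ?_⟩
      by_cases hyK : y ∈ K
      · simp only [t, dif_pos hyK, comp_apply, hΨf y hyK hy, mem_singleton_iff]
      · simp only [t, dif_neg hyK, mem_univ]
    · refine ⟨Kᶜ, hK.isOpen_compl.mem_nhds hx, fun _ => 0, contMDiffOn_const, fun y hy => ?_⟩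
      simp only [t, dif_neg (show y ∉ K from hy), mem_univ]
  obtain ⟨G, hG⟩ := exists_contMDiffMap_forall_mem_convex_of_local (𝓡 4) ht hloc' (n := ⊤)
  have hGK : ∀ y : ↥K, G y = j (f y) := fun y => by
    have h := hG y
    simp only [t, dif_pos y.2, mem_singleton_iff] at h
    exact h
  refine ⟨G ⁻¹' normalTube (𝓡 4) j ε, normalRetraction (𝓡 4) j ε ∘ G, hW.preimage G.2.continuous,
    fun y hy => ?_, ?_, fun y => ?_⟩
  · show G y ∈ normalTube (𝓡 4) j ε
    rw [hGK ⟨y, hy⟩]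
    exact (hrj _).1
  · exact hr.comp G.2.contMDiffOn fun x hx => hx
  · show normalRetraction (𝓡 4) j ε (G y) = f y
    rw [hGK y]
    exact (hrj _).2

end Gluing

/-! ## The central surface as the boundary of the clause-(iii) handlebody -/

section CentralHomeo

variable {X : Type*} [TopologicalSpace X] {S : Fin 3 → Set X}
  {M : Type*} [TopologicalSpace M] [ChartedSpace (EuclideanHalfSpace 3) M]

/-- **`∂H ≃ₜ F` along a clause-(iii) embedding** `f : H → X` with `f(∂H) = F = ⋂ S l`: `f`
restricted to the subtype `∂H` is an embedding onto `F`, whence a homeomorphism that is `f` on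
points. [cite: GayKirby2016, Def. 1 and Remark 2 (p. 3098)] -/
theorem exists_homeomorph_boundary_centralSurface {f : M → X} (hf : Topology.IsEmbedding f)
    (hbd : f '' (𝓡∂ 3).boundary M = ⋂ l, S l) :
    ∃ e : ↥((𝓡∂ 3).boundary M) ≃ₜ centralSurface S, ∀ w, ((e w : centralSurface S) : X) = f w :=
  ⟨(hf.comp Topology.IsEmbedding.subtypeVal).toHomeomorph.trans
    (Homeomorph.setCongr (by rw [range_comp, Subtype.range_coe, hbd])), fun _ => rfl⟩

end CentralHomeo

/-! ## `π₁` bookkeeping -/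

section Transport

variable {A B C D : Type*} [TopologicalSpace A] [TopologicalSpace B] [TopologicalSpace C]
  [TopologicalSpace D]

/-- `π₁` of a triple composite of based homeomorphisms is the triple composite (functoriality,
Hatcher Prop. 1.18). [cite: HatcherAT2002, Prop. 1.18 (p. 37)] -/
theorem FundamentalGroup.mapOfEq_trans_trans_apply (e₁ : A ≃ₜ B) (e₂ : B ≃ₜ C) (e₃ : C ≃ₜ D) {a : A} {b : B} {c : C}
    {d : D} (h₁ : e₁ a = b) (h₂ : e₂ b = c) (h₃ : e₃ c = d)
    (h : (e₁.trans e₂).trans e₃ a = d) (γ : FundamentalGroup A a) :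
    FundamentalGroup.mapOfEq
        (⟨(e₁.trans e₂).trans e₃, ((e₁.trans e₂).trans e₃).continuous⟩ : C(A, D)) h γ =
      FundamentalGroup.mapOfEq (e₃ : C(C, D)) h₃
        (FundamentalGroup.mapOfEq (e₂ : C(B, C)) h₂ (FundamentalGroup.mapOfEq (e₁ : C(A, B)) h₁ γ)) := by
  rw [← FundamentalGroup.mapOfEq_comp_apply, ← FundamentalGroup.mapOfEq_comp_apply]
  rfl

end Transport


end Literature.Topology.FourManifolds

end
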